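import Summits.CriticalPhenomena.Ising3D.Control2DL17BoxYTable
import Mathlib.Tactic.NormNum
import HarnessLib

/-!
# P9(a) candidate certificate (lead g22 kit job, not an RB round) `j195171_functional_deriv2d_L17_E040_sig1o8_box0.977-0.982.json` (Λ = 17, E₀ = 40): Δ_ε ∉ [977/1000, 491/500] at Δ_σ = 1/8 under A2D′ — (R), the large-`S` half, in the kernel
(cell `pub-ising3x`, seat controls-1 gen 22; KERNEL PATH for the 2D γ-certificates, Λ = 17 — CONTROL-ONLY)

HONEST FRAMING: lottery ticket; floor = tightest certified 3D Ising CFT bounds; no exact-solution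
claim without a proof. CONTROL-ONLY (`d = 2`, `Δ_σ = 1/8`, the 2D Ising control; axiom set `A2D′`).

(R) for the table `wtboxY` (`Control2DL17BoxYTable`), kernel data only: the compactified region polynomial `QhatboxY`
(`S₁ = 90`, `d = 17`) is non-negative on `τ ∈ [0,1]`, `v ∈ [0,1]` by the tensor-Bernstein SHAPE tree `cregboxY`
(7 leaves; every Bernstein coefficient computed and decided in the kernel, `Control2DPolyCertAuto2`, in 1 chunks of
≤ 12 leaves re-assembled along the splits), and `S ≤ S₁` by the per-`J` shapes `cregJboxY` of the Table file;
the root fact `cregboxY_n0` and the per-`J` fact `cregJboxY_ok` are turned into hypothesis `hR` by `region_of_kernelCertAuto` INSIDE the assembly file `Control2DL17BoxY` (no standalone `region_boxY` theorem: its statement would coincide, up to the table's name, with the other Λ = 17 boxes' — gate dedup lint, controls-1 g17). No facts, standard axioms only.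
-/

namespace Summit.CriticalPhenomena.Ising3D.Control2D

open Literature.MathematicalPhysics.QuantumFieldTheory.ConformalBootstrap3D

set_option maxHeartbeats 0 in
set_option maxRecDepth 200000 in
/-- Chunk 0 of the large-`S` tree (box `q₁=1, a₁=0; q₂=1, a₂=0`; 7 leaves), decided in the kernel. [folklore] -/
theorem cregboxY_n0 :
    checkAuto₂ QhatboxY 18 1 0 1 1 0 1
    (Shape₂.splitO (Shape₂.splitI (Shape₂.leaf) (Shape₂.leaf)) (Shape₂.splitI (Shape₂.leaf) (Shape₂.splitO (Shape₂.splitI (Shape₂.leaf) (Shape₂.leaf)) (Shape₂.splitI (Shape₂.leaf) (Shape₂.leaf))))) = true := by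
  decide +kernel

end Summit.CriticalPhenomena.Ising3D.Control2D
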